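import Summits.BirchSwinnertonDyer.BirchSwinnertonDyer.Theorems.CumulativeHeegnerLeopoldtCumulativeHeegnerInclusionAtThreeLayerControlCell
import Summits.BirchSwinnertonDyer.BirchSwinnertonDyer.Theorems.CumulativeHeegnerLeopoldtCumulativeHeegnerInclusionAtThreeLayerControlDual
import HarnessLib

/-!
# Crux K1 `CumulativeHeegnerInclusionAtThree` (stmt-BirchSwinnertonDyer-24198) / crux A (stmt-26896): the
# port [P-ctl], VI — the KERNEL `C_n = ker q_n` of the dual layer map for K1's own `Σ = ∅`:
# `p^a · (Sel[ω_n] / im s_n) = 0 ⟹ p^a · C_n = 0`, and `q_n` is onto at every layer on the Leopoldt cell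

Width seat bsd-line-chl-k1-p1-w8 (`--supports stmt-BirchSwinnertonDyer-24198`). THEOREMS ONLY (no definition, no named
fact, no `sorry`); ROUTE-INDEPENDENT. For K1's own module `X_{∅,0}(𝔭′)` (`Σ = ∅`) control along the tower is NOT exact:
`coker s_n ↪ ⊕_{w ∣ v, v ∣ N, v ∤ 3} ker r_{n,w}` (Tamagawa-type kernels at the bad split places, finitely decomposed in
`K_∞^{ac}`; Greenberg LNM 1716 §3 Lemma 3.3). In the dual packaging of IV (`q_n : X ⧸ ω_n X → Hom(Sel_𝔭(K_n), ℚ/ℤ)`,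
`q_n [x] = x ∘ u`) the layer datum `C_n` of `…LayerTowerControl.forall_pow_mul_mem_map_fittingIdeal_sup_layer` is
`ker q_n` (with `j_n` its inclusion — exact by definition), and what that consumer needs about it is an `m`-UNIFORM
annihilator `p^a` and generator count `g`. This file proves the annihilator transfer and the cell-level surjectivity:

* §1 `smul_eq_zero_of_ker_dualLayerMap` — if `p^a · Sel_𝔭^Σ(K_∞)[ω_n] ⊆ im s_n` (i.e. `p^a` kills `coker s_n`), then
  `p^a · z = 0` for every `z ∈ ker q_n` (exactness of Pontryagin duality at `X ⧸ ω_n X`, tree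
  `IsDualPair.exists_eq_smul_of_forall_ker`); `exact_subtype_ker_dualLayerMap` — `ker q_n ↪ X ⧸ ω_n X ↠ im q_n` is exact.
* §2 `cell_exists_dualLayerMap_surjective` — on the Leopoldt cell (every `ℤ₃`-tower, generator, `𝔭′ ∋ 3`, `Σ`, `n`) the dual
  layer map is ONTO `Hom(Sel_{𝔭′}^Σ(K_n, E[3^∞]), ℚ/ℤ)` (`s_n` injective: `E(K_∞)[3^∞] = 0` on the cell, III).

Not here: the generator count of `ker q_n` and the order of `coker s_n` at layer `n` (the local Tamagawa-type theory at the
bad `v ∣ N`, `v ∤ 3` along the tower — Greenberg's `#ker r_{n,v}`), which is where an `m`-uniform `(a, g)` must come from.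
Crux A (26896) and K1 (24198) stay OPEN; BSD is not proved by any of this; no summit statement is proved by this seat.

References: [GreenbergLNM1716] §3 Lemma 3.3 (pp. 74–75, 87) and p. 90; §1 p. 62; [MazurTate1987] §1.
-/

set_option linter.dupNamespace false
set_option autoImplicit false

noncomputable section

open scoped Classical

namespace Summit.BirchSwinnertonDyer.BirchSwinnertonDyer.Theorems.CumulativeHeegnerInclusionAtThreeLayerControlDualKernel

open NumberField IsDedekindDomain Field
open Literature.NumberTheory.EllipticCurves Literature.NumberTheory.EllipticCurves.GreenbergSelmer
open Literature.NumberTheory.EllipticCurves.IwasawaDual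
open Literature.NumberTheory.GaloisRepresentations
open Summit.BirchSwinnertonDyer.Rank1Residual.X11b Summit.BirchSwinnertonDyer.Rank1Residual.X11b.AcSelmer
open Summit.BirchSwinnertonDyer.BirchSwinnertonDyer.Theorems.BiquadraticEisensteinDescentDefs
open Summit.BirchSwinnertonDyer.BirchSwinnertonDyer.Theorems.CumulativeHeegnerInclusionAtThreeLayerControlDual
open Summit.BirchSwinnertonDyer.BirchSwinnertonDyer.Theorems.CumulativeHeegnerInclusionAtThreeLayerControlCell

/-! ## §1 `p^a · coker s_n = 0 ⟹ p^a · ker q_n = 0` -/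

section Kernel

variable {K : Type} [Field K] [NumberField K] {p : ℕ} [Fact p.Prime] (κ : ZpExtension K p)
  (W : WeierstrassCurve K) (𝔭 : HeightOneSpectrum (𝓞 K)) (S : Set (HeightOneSpectrum (𝓞 K)))
  (γ : absoluteGaloisGroup K) [hγ : Fact (κ.IsTopGenerator γ)] (n : ℕ)

/-- **Annihilator transfer `coker s_n → ker q_n`.** Let `q : X_ac^Σ ⧸ ω_n X_ac^Σ → Hom(Sel_𝔭^Σ(K_n, E[p^∞]), ℚ/ℤ)` have the
defining property of IV (`q [x] = x ∘ u`, `u` agreeing with `res_{K_n→K_∞}`). If `p^a` kills the cokernel of `s_n` inside the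
invariants — every `conj_{γ^{pⁿ}}`-fixed class `b` of `Sel_𝔭^Σ(K_∞, E[p^∞])` has `p^a · b = res_{K_n→K_∞} c` for some Selmer
class `c` over `K_n` — then `p^a · z = 0` for every `z ∈ ker q`: a character `x` with `x ∘ u = 0` has `p^a · x` killing
`ker ((conj_γ)^{pⁿ} − 1)`, hence `p^a · x ∈ ω_n X` (tree `IsDualPair.exists_eq_smul_of_forall_ker`). So `C_n := ker q_n`
is killed by `p^a` as soon as `coker s_n` is. [cite: GreenbergLNM1716, §3 p. 90 and §1 p. 62] [cite: MazurTate1987, §1] -/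
theorem smul_eq_zero_of_ker_dualLayerMap
    {f : AddMonoid.End ↥(selmerOver (κ.layerSubgroup n) (W.geomPrimaryTorsion p) p 𝔭 S)}
    {h : IsLocNil p (f - 1)}
    (u : ↥(selmerOver (κ.layerSubgroup n) (W.geomPrimaryTorsion p) p 𝔭 S) →+ ↥(selmerAc W p κ 𝔭 S))
    (hu : ∀ c, ((u c : selmerAc W p κ 𝔭 S) : W.subgroupH1 p κ.kerSubgroup) =
      W.resOfLe p (κ.kerSubgroup_le_layerSubgroup n) c)
    (q : (XAc W p κ 𝔭 S γ ⧸ (Ideal.span {((1 + PowerSeries.X : IwasawaAlgebra p) ^ (p ^ n) - 1)} •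
        (⊤ : Submodule (IwasawaAlgebra p) (XAc W p κ 𝔭 S γ)))) →ₗ[IwasawaAlgebra p]
        LocNilDual (selmerOver (κ.layerSubgroup n) (W.geomPrimaryTorsion p) p 𝔭 S) f h)
    (hq : ∀ (x : XAc W p κ 𝔭 S γ) (c : selmerOver (κ.layerSubgroup n) (W.geomPrimaryTorsion p) p 𝔭 S),
      q (Submodule.Quotient.mk x) c = x (u c))
    {a : ℕ}
    (hcoker : ∀ b ∈ selmerAc W p κ 𝔭 S, W.conjH1 p κ.kerSubgroup (γ ^ p ^ n) b = b →
      ∃ c ∈ selmerOver (κ.layerSubgroup n) (W.geomPrimaryTorsion p) p 𝔭 S,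
        W.resOfLe p (κ.kerSubgroup_le_layerSubgroup n) c = p ^ a • b)
    {z : XAc W p κ 𝔭 S γ ⧸ (Ideal.span {((1 + PowerSeries.X : IwasawaAlgebra p) ^ (p ^ n) - 1)} •
        (⊤ : Submodule (IwasawaAlgebra p) (XAc W p κ 𝔭 S γ)))}
    (hz : q z = 0) : p ^ a • z = 0 := by
  obtain ⟨x, rfl⟩ := Submodule.Quotient.mk_surjective _ z
  -- `p^a • x` kills `ker ((conj_γ)^{pⁿ} − 1)`
  have hx : ∀ b : selmerAc W p κ 𝔭 S, ((conjSelmerAc W p κ 𝔭 S γ) ^ p ^ n - 1) b = 0 →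
      (AddMonoidHom.id (XAc W p κ 𝔭 S γ)) (p ^ a • x) b = 0 := by
    intro b hb
    show (p ^ a • x) b = 0
    rw [IwasawaDual.End_sub_apply, AddMonoid.End.one_apply, sub_eq_zero] at hb
    have hb' : W.conjH1 p κ.kerSubgroup (γ ^ p ^ n) (b : W.subgroupH1 p κ.kerSubgroup) = b := by
      rw [← coe_conjSelmerAc_pow_apply, hb]
    obtain ⟨c, hc, hcb⟩ := hcoker b b.2 hb'
    have huc : u ⟨c, hc⟩ = p ^ a • b := Subtype.ext (by rw [hu, AddSubgroupClass.coe_nsmul]; exact hcb)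
    have h0 := hq x ⟨c, hc⟩
    rw [hz, huc, map_nsmul] at h0
    have e : (p ^ a • x) b = p ^ a • x b := rfl
    rw [e, ← h0]
    rfl
  obtain ⟨y, hy⟩ := (XAc.isDualPair W p κ 𝔭 S γ).exists_eq_smul_of_forall_ker
    ((XAc.isDualPair W p κ 𝔭 S γ).toDual_omega_smul n) hx
  have hmk := map_nsmul (Submodule.mkQ (Ideal.span {((1 + PowerSeries.X : IwasawaAlgebra p) ^ (p ^ n) - 1)} •
    (⊤ : Submodule (IwasawaAlgebra p) (XAc W p κ 𝔭 S γ)))) (p ^ a) x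
  rw [Submodule.mkQ_apply, Submodule.mkQ_apply] at hmk
  rw [← hmk, hy]
  exact (Submodule.Quotient.mk_eq_zero _).mpr
    (Submodule.smul_mem_smul (Ideal.mem_span_singleton_self _) Submodule.mem_top)

omit hγ in
/-- In the currency of the (LT) consumer: `PowerSeries.C (p^a) ∈ Λ` acts as the integer `p^a`, so under the same
hypothesis `C(p^a) · z = 0` for every `z ∈ ker q` — i.e. `C(p^a) ∈ Ann_Λ(ker q_n)` as required of the layer datum
`C_n = ker q_n` in `…LayerTowerControl.forall_pow_mul_mem_map_fittingIdeal_sup_layer`. [cite: MazurTate1987, §1] -/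
theorem C_pow_smul_eq_natCast_pow_smul {M : Type*} [AddCommGroup M] [Module (IwasawaAlgebra p) M] (a : ℕ) (z : M) :
    (PowerSeries.C ((p : ℤ_[p]) ^ a) : IwasawaAlgebra p) • z = p ^ a • z := by
  rw [map_pow, map_natCast, ← Nat.cast_pow, Nat.cast_smul_eq_nsmul]

/-- **`ker q_n ↪ X ⧸ ω_n X → Hom(Sel_𝔭^Σ(K_n), ℚ/ℤ)` is exact** (tautologically), so with `C_n := ker q_n` and `j_n` its
inclusion the first two requirements on the layer data of `…LayerTowerControl` hold for ANY `q_n`; surjectivity of `q_n`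
is IV `dualLayerMap_surjective_of_injective` (§2 on the cell). [folklore] -/
theorem exact_subtype_ker {R M N : Type*} [CommRing R] [AddCommGroup M] [Module R M] [AddCommGroup N] [Module R N]
    (q : M →ₗ[R] N) : Function.Exact (LinearMap.ker q).subtype q :=
  LinearMap.exact_subtype_ker_map q

end Kernel

/-! ## §2 On the Leopoldt cell the dual layer map is onto at every layer, every `Σ` -/

/-- **`q_n` is ONTO on the Leopoldt cell**, for every `ℤ₃`-extension `κ` with topological generator `γ`, every `𝔭′ ∋ 3`,
every `Σ` (in particular K1's `Σ = ∅`) and every layer `n`: `s_n` is injective there (`E(K_∞)[3^∞] = 0`, III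
`cell_layerControl_injective`), so every character of `Sel_{𝔭′}^Σ(K_n, E[3^∞])` extends (IV). With §1: the layer data
`ker q_n → X_{Σ} ⧸ ω_n X_{Σ} → Hom(Sel_{𝔭′}^Σ(K_n, E[3^∞]), ℚ/ℤ) → 0` of the (LT) consumer EXIST on the cell at every layer;
what remains for `Σ = ∅` is an `n`-UNIFORM annihilator/generator bound for `coker s_n` (bad places `v ∣ N`, `v ∤ 3`).
[cite: GreenbergLNM1716, §3 Lemma 3.1 and p. 90] -/
theorem cell_exists_dualLayerMap_surjective :
    ∀ (W : WeierstrassCurve ℚ) [W.IsElliptic] [W.IsGloballyMinimal] (N : ℕ) [NeZero N] (K : Type) [Field K]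
      [NumberField K], Summit.BirchSwinnertonDyer.Rank1Residual.Additive.ClassO6 W 3 →
      (∃ Φ : AddSubgroup (WeierstrassCurve.geomTorsion W ((3 : ℕ) : ℤ)),
        Literature.NumberTheory.EllipticCurves.Rank1Residual.IsRationalLine W 3 Φ ∧
        ∀ (v : IsDedekindDomain.HeightOneSpectrum (NumberField.RingOfIntegers ℚ)),
          ((3 : ℕ) : NumberField.RingOfIntegers ℚ) ∈ v.asIdeal → ∀ 𝔓 ∈ v.primesAbove,
          ¬ (∀ g ∈ 𝔓.decompositionSubgroup (Field.absoluteGaloisGroup ℚ), ∀ P ∈ Φ, g • P = P) ∧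
          ¬ (∀ g ∈ 𝔓.decompositionSubgroup (Field.absoluteGaloisGroup ℚ),
              ∀ P : WeierstrassCurve.geomTorsion W ((3 : ℕ) : ℤ), g • P - P ∈ Φ)) →
      W.conductorNorm ℤ = N → Literature.NumberTheory.EllipticCurves.IsImaginaryQuadratic K →
      Literature.NumberTheory.EllipticCurves.SatisfiesHeegnerHypothesis N K →
      ∀ (κ : Literature.NumberTheory.EllipticCurves.ZpExtension K 3) (γ : Field.absoluteGaloisGroup K)
        [Fact (κ.IsTopGenerator γ)]
        (𝔭' : IsDedekindDomain.HeightOneSpectrum (NumberField.RingOfIntegers K)),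
      ∀ (S : Set (IsDedekindDomain.HeightOneSpectrum (NumberField.RingOfIntegers K))) (n : ℕ),
      haveI : (W.baseChange K).IsElliptic := inferInstanceAs (W.map (algebraMap ℚ K)).IsElliptic
      ∀ (f : AddMonoid.End ↥(selmerOver (κ.layerSubgroup n) ((W.baseChange K).geomPrimaryTorsion 3) 3 𝔭' S))
        (_ : ∀ s, ((f s : selmerOver (κ.layerSubgroup n) ((W.baseChange K).geomPrimaryTorsion 3) 3 𝔭' S) :
          (W.baseChange K).subgroupH1 3 (κ.layerSubgroup n)) = (W.baseChange K).conjH1 3 (κ.layerSubgroup n) γ s)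
        (h : IsLocNil 3 (f - 1))
        (u : ↥(selmerOver (κ.layerSubgroup n) ((W.baseChange K).geomPrimaryTorsion 3) 3 𝔭' S) →+
          ↥(selmerAc (W.baseChange K) 3 κ 𝔭' S))
        (_ : ∀ c, ((u c : selmerAc (W.baseChange K) 3 κ 𝔭' S) : (W.baseChange K).subgroupH1 3 κ.kerSubgroup) =
          (W.baseChange K).resOfLe 3 (κ.kerSubgroup_le_layerSubgroup n) c),
      ∃ q : (XAc (W.baseChange K) 3 κ 𝔭' S γ ⧸
          (Ideal.span {((1 + PowerSeries.X : IwasawaAlgebra 3) ^ (3 ^ n) - 1)} •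
            (⊤ : Submodule (IwasawaAlgebra 3) (XAc (W.baseChange K) 3 κ 𝔭' S γ)))) →ₗ[IwasawaAlgebra 3]
          LocNilDual (selmerOver (κ.layerSubgroup n) ((W.baseChange K).geomPrimaryTorsion 3) 3 𝔭' S) f h,
        Function.Surjective q ∧
          ∀ (x : XAc (W.baseChange K) 3 κ 𝔭' S γ)
            (c : selmerOver (κ.layerSubgroup n) ((W.baseChange K).geomPrimaryTorsion 3) 3 𝔭' S),
            q (Submodule.Quotient.mk x) c = x (u c) := by
  intro W _ _ N _ K _ _ hO6 hline hN hK hHg κ γ hγ 𝔭' S n f hf h u hu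
  haveI : Fact (Nat.Prime 3) := ⟨Nat.prime_three⟩
  haveI hEK : (W.baseChange K).IsElliptic := inferInstanceAs (W.map (algebraMap ℚ K)).IsElliptic
  obtain ⟨q, hq⟩ := exists_dualLayerMap κ (W.baseChange K) 𝔭' S γ n f hf h u hu
  exact ⟨q, dualLayerMap_surjective_of_injective κ (W.baseChange K) 𝔭' S γ n u hu q hq
    (cell_layerControl_injective W N K hO6 hline hN hK hHg κ n), hq⟩

end Summit.BirchSwinnertonDyer.BirchSwinnertonDyer.Theorems.CumulativeHeegnerInclusionAtThreeLayerControlDualKernel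

end
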